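import Summits.QuantumFields.GaugeBoot.TiltedBoxSquareSlab
import Summits.QuantumFields.GaugeBoot.TwistedSlabIntegral
import HarnessLib

/-!
# The slab step on the square tilted box: transferring a plaquette one layer down (gauge-boot, L3 negative supplement; twisted-slab mechanism, the integral identity for every side and layer)

HONEST FRAMING (cell `pub-gaugeboot`, page 1 of every file): the venture produces certified bounds
on lattice expectations at stated coupling, gauge group, dimension and torus size; NOT a mass gap,
NOT a continuum limit, NOT a string tension; NOT Yang–Mills-summit-bearing (barriers
`FixedCouplingUltralocality`, `PerturbativeInvisibility`). The integral identity behind the NEGATIVE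
results `TiltedBoxOddAxisRPNegative.lean` (odd side, proved there for `M = 2P + 1`, layer `P`, frozen
factor a plaquette observable) and `TiltedBoxEvenMidAxisRPNegative.lean` (even side), stated once for
the square tilted box `ℤ^d/Γ(M, M, L)` of ANY side `M ≥ 2`, ANY layer `a ∈ ℤ/M` and ANY frozen factor.

**`SquareSlab.slab_step`.** Let `q = (a', b')` be a transverse direction pair (`a', b' ≠ i`,
`e_{a'}, e_{b'} ≠ 0` in the box), `y` a site of the layer `x_i ≡ a`, `w_β = exp(β Re tr ρ)` the
one-plaquette weight with `∫ w_β(k) ρ(k) dk = c · 1` (`TwistedSlab.HasScalarCommutant`), and `f` a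
continuous function of the configuration OFF the block of the layer `a + 1`
(`SquareSlab.block … a`: the transverse links of the layer `a + 1`). Then, for the product Haar
measure `μ₀`,

  `∫ f(U) · Re tr ρ(U_{(y + e_i; q)}) · ∏_{t ∈ block} w_β(a_t(U) U_t⁻¹ b_t(U)) dμ₀(U)
     = z^{|block| - 4} c⁴ · ∫ f(U) · Re tr ρ(U_{(y; q)}) dμ₀(U)`,   `z = ∫ w_β`,

i.e. integrating out the layer `a + 1` against the slab weights (`SquareSlab.prod_exp_slab_eq`)
replaces the plaquette `(y + e_i; q)` ABOVE the slab by the plaquette `(y; q)` BELOW it, up to the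
positive constant `z^{|block|-4} c⁴` (`TwistedSlab.slab_integral_frozen` + `SquareSlab.re_trace_slabWord`).
This is the transfer-matrix reading of the slab; the twist of an in-plane mirror enters only through
WHICH plaquette below is produced. `[folklore]` mechanism (Osterwalder–Seiler slab factorisation).

References: K. Osterwalder, E. Seiler, Ann. Phys. 110 (1978) 440, §2; J. Fröhlich, R. Israel,
E. H. Lieb, B. Simon, J. Stat. Phys. 22 (1980) 297, §3; M. Biskup, in LNM 1970 (2009) §5.5.
-/

noncomputable section

open MeasureTheory QuotientAddGroup
open Literature.MathematicalPhysics.QuantumFieldTheory (haarProbability)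
open Literature.RepresentationTheory.CompactGroups

namespace Summit.QuantumFields.GaugeBoot

namespace TiltedRP

namespace SquareSlab

section Step

variable {d : ℕ} {i j : Fin d} {L M N : ℕ} [NeZero M] [NeZero L]
variable {G : Type*} [Group G] [TopologicalSpace G] [IsTopologicalGroup G] [CompactSpace G]
  [MeasurableSpace G] [BorelSpace G] [SecondCountableTopology G]
variable (ρ : G →* Matrix (Fin N) (Fin N) ℂ) (q : DirPair d)

omit [CompactSpace G] [MeasurableSpace G] [BorelSpace G] [SecondCountableTopology G] in
/-- Continuity of the block weight product (as a complex-valued function). [folklore] -/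
theorem continuous_slabProd [DecidableEq (TiltedSite d i j M M L)] (hρ : Continuous ρ) (β : ℝ) (a : ZMod M) :
    Continuous fun U : Config (TiltedSite d i j M M L) d G =>
      ∏ t ∈ block d i j L M a, (TwistedSlab.wilsonWeight ρ β (frozenA a t U * (U t)⁻¹ * frozenB a t U) : ℂ) :=
  continuous_finsetProd _ fun t _ => Complex.continuous_ofReal.comp
    ((TwistedSlab.continuous_wilsonWeight ρ hρ β).comp
      (((continuous_frozenA a t).mul (continuous_apply t).inv).mul (continuous_frozenB a t)))

omit [CompactSpace G] [MeasurableSpace G] [BorelSpace G] [SecondCountableTopology G] [NeZero M] [NeZero L] in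
/-- Continuity of a transverse plaquette observable, complex-valued. [folklore] -/
theorem continuous_plaqObs_complex (hρ : Continuous ρ) (p : Plaq (TiltedSite d i j M M L) d) :
    Continuous fun U : Config (TiltedSite d i j M M L) d G =>
      ((plaqObs ρ (tiltedUnit d i j M M L) p U : ℝ) : ℂ) :=
  Complex.continuous_ofReal.comp (continuous_plaqObs ρ hρ _ p)

/-- **The slab step with a frozen factor.** For `y` in the layer `a` (`x_i(y) = a`), a transverse
direction pair `q` and a continuous `f` depending only on links off the block of the layer `a + 1`:
`∫ f · W_{(y + e_i; q)} · ∏_{t∈block} w_β(a_t U_t⁻¹ b_t) dμ₀ = z^{|block|-4} c⁴ ∫ f · W_{(y; q)} dμ₀`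
— the plaquette of the layer above the slab is transferred to the plaquette below it. Needs
`M ≥ 2` (so that the layer `a` is off the block) and `e_{q₁}, e_{q₂} ≠ 0` (so that the four links of
the plaquette above are distinct). [folklore] -/
theorem slab_step [Fact (1 < M)] [DecidableEq (TiltedSite d i j M M L)]
    (hq1 : q.1.1 ≠ i) (hq2 : q.1.2 ≠ i)
    (he1 : tiltedUnit d i j M M L q.1.1 ≠ 0) (he2 : tiltedUnit d i j M M L q.1.2 ≠ 0)
    (hρ : Continuous ρ) {β : ℝ} {c : ℂ}
    (hc : TwistedSlab.wAvg ρ (TwistedSlab.wilsonWeight ρ β) = c • (1 : Matrix (Fin N) (Fin N) ℂ))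
    {a : ZMod M} (f : Config (TiltedSite d i j M M L) d G → ℂ) (hf : Continuous f)
    (hfC : DependsOn f (((block d i j L M a)ᶜ : Finset _) : Set _))
    (y : TiltedSite d i j M M L) (hy : axisCoord d L M y = a) :
    ∫ U, f U * ((plaqObs ρ (tiltedUnit d i j M M L) (y + tiltedUnit d i j M M L i, q) U : ℝ) : ℂ) *
        ∏ t ∈ block d i j L M a, (TwistedSlab.wilsonWeight ρ β (frozenA a t U * (U t)⁻¹ * frozenB a t U) : ℂ)
        ∂(productHaar (TiltedSite d i j M M L) d G) =
      (∫ k, (TwistedSlab.wilsonWeight ρ β k : ℂ) ∂(haarProbability G)) ^ ((block d i j L M a).card - 4) *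
        c ^ 4 * ∫ U, f U * ((plaqObs ρ (tiltedUnit d i j M M L) (y, q) U : ℝ) : ℂ)
          ∂(productHaar (TiltedSite d i j M M L) d G) := by
  have hab : q.1.1 ≠ q.1.2 := ne_of_lt q.2
  -- the four links of the plaquette above
  have h0 : (y + tiltedUnit d i j M M L i, q.1.1) ∈ block d i j L M a := by
    simpa using mem_block_above y hy q.1.1 hq1 0 (map_zero _)
  have h3 : (y + tiltedUnit d i j M M L i, q.1.2) ∈ block d i j L M a := by
    simpa using mem_block_above y hy q.1.2 hq2 0 (map_zero _)
  have h1 : (y + tiltedUnit d i j M M L i + tiltedUnit d i j M M L q.1.1, q.1.2) ∈ block d i j L M a :=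
    mem_block_above y hy q.1.2 hq2 _ (axisCoord_tiltedUnit_of_ne d L _ hq1)
  have h2 : (y + tiltedUnit d i j M M L i + tiltedUnit d i j M M L q.1.2, q.1.1) ∈ block d i j L M a :=
    mem_block_above y hy q.1.1 hq1 _ (axisCoord_tiltedUnit_of_ne d L _ hq2)
  have hne0 : ∀ (v w : TiltedSite d i j M M L) (m m' : Fin d), m ≠ m' →
      ((v, m) : Link _ d) ≠ (w, m') := fun v w m m' h hh => h (congrArg Prod.snd hh)
  have hy2 : y + tiltedUnit d i j M M L i ≠ y + tiltedUnit d i j M M L i + tiltedUnit d i j M M L q.1.2 :=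
    fun h => he2 (by simpa using h.symm)
  have hy1 : y + tiltedUnit d i j M M L i + tiltedUnit d i j M M L q.1.1 ≠ y + tiltedUnit d i j M M L i :=
    fun h => he1 (by simpa using h)
  have h := TwistedSlab.slab_integral_frozen ρ (TwistedSlab.continuous_wilsonWeight ρ hρ β)
    (TwistedSlab.wilsonWeight_inv ρ hρ β) hc hρ (block d i j L M a) (frozenA a) (frozenB a)
    (continuous_frozenA a) (continuous_frozenB a) (dependsOn_frozenA a) (dependsOn_frozenB a)
    f hf hfC h0 h1 h2 h3 (hne0 _ _ _ _ hab) (fun hh => hy2 (congrArg Prod.fst hh)) (hne0 _ _ _ _ hab)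
    (hne0 _ _ _ _ hab.symm) (fun hh => hy1 (congrArg Prod.fst hh)) (hne0 _ _ _ _ hab)
  -- the plaquette above is `U t₀ U t₁ U t₂⁻¹ U t₃⁻¹`, the word below is `U_{(y; q)}`
  have hup : ∀ U : Config (TiltedSite d i j M M L) d G,
      plaqObs ρ (tiltedUnit d i j M M L) (y + tiltedUnit d i j M M L i, q) U =
        ((ρ (U (y + tiltedUnit d i j M M L i, q.1.1) *
          U (y + tiltedUnit d i j M M L i + tiltedUnit d i j M M L q.1.1, q.1.2) *
          (U (y + tiltedUnit d i j M M L i + tiltedUnit d i j M M L q.1.2, q.1.1))⁻¹ *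
          (U (y + tiltedUnit d i j M M L i, q.1.2))⁻¹)).trace).re := fun U => rfl
  have hdown := re_trace_slabWord ρ y hq1 hq2 hy
  simp_rw [hup]
  rw [h]
  congr 1
  refine integral_congr_ae (ae_of_all _ fun U => ?_)
  dsimp only
  rw [hdown U]
  rfl

end Step

end SquareSlab

end TiltedRP

end Summit.QuantumFields.GaugeBoot

end
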